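import Mathlib
import Literature.Analysis.FluidPDE.TypeIAncientMild
import Summits.NavierStokesRegularity.NavierStokesRegularity.Theses.SymmetryModuliCount
import Summits.NavierStokesRegularity.NavierStokesRegularity.Theorems.SymmetryModuliCountFarPastLedger

/-!
# Witness of weakness / floor-as-special-case for the rung `LedgerHigherIntegrability`
# (crux `SymmetryModuliCount.ForcedSymmetry`, stmt-NavierStokesRegularity-4052; floor stmt-14060)

Self-contained F3 / BC5 witness file (`Lines/LedgerHigherIntegrability_special.lean`).  The graded family
of the line `Lines/LedgerHigherIntegrability.lean` is the scale-invariant `L^p`-Morrey ledger on the Type-I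
ancient mild class `A_C`,

  `Ledger p C := ∃ K, ∀ u ∈ A_C, ∀ t < 0, ∀ x₀ R, 0 < R → ∫_{B_R(x₀)} ‖u t x‖^p ≤ K · R^{3-p}`,
  `LedgerRung p := ∀ C, Ledger p C`,

(definitions copied verbatim from the skeleton, namespace `…Cruxes.ForcedSymmetry.LedgerHigherIntegrability`).
THIS FILE PROVES: the floor `FarPastLedger` (landed, `Theorems.FarPastLedger_proof`) is LITERALLY the rung
family at parameter `p = 2` — `ledgerRung_two : LedgerRung 2` and `ledgerRung_two_iff_floor` — so the rung
`LedgerHigherIntegrability := ∀ C, ∃ p > 2, Ledger p C` moves exactly one parameter (the Morrey exponent)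
off the floor.

Why this case lies outside the summit's known regime: `LedgerRung 2` is a uniform scale-critical estimate on
the whole Type-I ancient mild class for EVERY Type-I constant `C` — a class not known to be trivial (that is
X = `TypeIAncientLiouville`, open: Bradshaw–Tsai OP 5.1, KNSS conjecture) and for which Albritton–Barker 2019
(Remark 3.2; p. 4 "boundedness of one of (a)–(c_∞) is not known to imply boundedness of the other quantities")
record the implication "temporal Type I ⇒ bounded scaled energies" as not known in print; it is not a
consequence of any proved case of `NavierStokesExistenceSmoothR3`.  It exercises the line's lever (the ledger)
at its first exponent.

No `sorry`.
-/

set_option linter.dupNamespace false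

namespace Summit.NavierStokesRegularity.NavierStokesRegularity.Cruxes.ForcedSymmetry.LedgerHigherIntegrabilitySpecial

open MeasureTheory Literature.Analysis.FluidPDE
open Summit.NavierStokesRegularity.NavierStokesRegularity.Theses.SymmetryModuliCount

local notation "E3" => EuclideanSpace ℝ (Fin 3)

/-- Verbatim copy of `…LedgerHigherIntegrability.Ledger`. -/
def Ledger (p C : ℝ) : Prop :=
  ∃ K : ℝ, ∀ u : ℝ → E3 → E3, IsTypeIAncientMild C u →
    ∀ t < 0, ∀ (x₀ : E3) (R : ℝ), 0 < R →
      ∫ x in Metric.ball x₀ R, ‖u t x‖ ^ p ≤ K * R ^ (3 - p)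

/-- Verbatim copy of `…LedgerHigherIntegrability.LedgerRung`. -/
def LedgerRung (p : ℝ) : Prop := ∀ C : ℝ, Ledger p C

/-- Verbatim copy of the rung `…LedgerHigherIntegrability.LedgerHigherIntegrability`. -/
def LedgerHigherIntegrability : Prop := ∀ C : ℝ, ∃ p : ℝ, 2 < p ∧ Ledger p C

/-- The rung family at `p = 2` IS the floor `FarPastLedger`, literally (up to `x ^ (2:ℝ) = x ^ 2`,
`R ^ (1:ℝ) = R`). -/
theorem ledgerRung_two_iff_floor : LedgerRung 2 ↔ FarPastLedger := by
  have e3 : (3 : ℝ) - 2 = 1 := by norm_num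
  simp only [LedgerRung, Ledger, FarPastLedger, Real.rpow_two, e3, Real.rpow_one]

/-- **F3 / BC5 witness**: the floor case of the rung family, from the landed floor theorem. -/
theorem ledgerRung_two : LedgerRung 2 :=
  ledgerRung_two_iff_floor.mpr Summit.NavierStokesRegularity.NavierStokesRegularity.Theorems.FarPastLedger_proof

end Summit.NavierStokesRegularity.NavierStokesRegularity.Cruxes.ForcedSymmetry.LedgerHigherIntegrabilitySpecial
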